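import Summits.ResolutionOfSingularities.KangarooAtlas.MizutaniAttainedForms
import HarnessLib

/-!
# Mizutani's `m(e)` — attainment over an ARBITRARY field, I: the point of `ℙ^{2q−1}` for a pair `u_0, u_1 ∈ k`

Cell topic `Summits/ResolutionOfSingularities/KangarooAtlas` (pub-rosobs); namespace
`Summit.ResolutionOfSingularities.KangarooAtlas.Mizutani.GenAtt`.  Part of the Lean transcription of the in-house
note MIZUTANI-PROOF-g59 (AI-written, AI-audited; *AI review is weaker than expert review*; NOT a resolution theorem).
The note's Corollary 10.1 says that Mizutani's value `2p^e − 1` is attained "as soon as `[k : k^p] ≥ p²`";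
encloser-1's `MizutaniAttained*.lean` realise it over ONE field, `𝔽_p(u_0, u_1)`.  This series
(`MizutaniAttainedGeneral*.lean`) does it over EVERY field `k` of characteristic `p` containing a `p`-independent pair.
This file is the general-field copy of `MizutaniAttainedPoint.lean` (same indices `attN`, `attIdx`, `attW` of
encloser-1; the field `RatField F 2` and its generators `ratGen` replaced by an arbitrary field `k` and a pair
`u : Fin 2 → k`):

  `GenAtt.attP k p e u = ker( k[X_0, …, X_N] → k[T], X_i ↦ u^{W_i} · T, scalars through F^e )`, `N + 1 = 2q`,

* `isPoint_attP` — a homogeneous prime not containing `S_+` (needs `u_l ≠ 0`);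
* `addForm_mem_attP_iff` — an additive form of level `e + m` lies in `attP` iff `Σ_i g_i c_i^{p^m} = 0`, `c_i = u^{W_i}`;
* `mem_invForms_attP_iff` — `a ∈ (L_B)_{e+m} ⟺ Σ_i a_i ⊗ c_i^{p^m} ∈ J^{p^{e+m}}` in `k ⊗_{k^{p^{e+m}}} k` (Oda's
  definition through encloser-2's duality `mem_ideal_pow_iff_forall_dPair`).

The tower coordinates (encloser-1's `Omega_attBeta`, which used `k = k^{p^e}(u)`) are replaced in part II by a
finite-witness argument inside `k^{p^{e+m}}(b′)` for a `p`-independent `b′ ⊇ {u_0, u_1}`.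
References: [Mizutani1973HironakaGroupSchemes] Remark 2.10 (the schemes `H_e`), Example 2.1; in-house note §10,
Cor. 10.1; [Oda1983HironakaGroupSchemeII] §2 (p. 1168), Thm. 3.1.
-/

open MvPolynomial TensorProduct Literature.AlgebraicGeometry.Resolution
  Literature.AlgebraicGeometry.Resolution.HironakaScheme

namespace Summit.ResolutionOfSingularities.KangarooAtlas.Mizutani.GenAtt

universe u

section Point

variable (k : Type u) [Field k] (p e : ℕ) [hp : Fact p.Prime] [CharP k p] (u : Fin 2 → k)

/-- The monomials `c_i = u^{W_i} = u_0^{ε_i} u_1^{j_i} ∈ k` (the right support of `t_0 t_1^{q−1}`; note §10).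
[cite: Mizutani1973HironakaGroupSchemes, Remark 2.10 (in-house proof §10: H = H_R(ω))] -/
noncomputable def attC (i : Fin (attN p e + 1)) : k := ∏ l, u l ^ attW p e i l

/-- The images `ξ_i = c_i · T` of the homogeneous coordinates. [cite: Oda1983HironakaGroupSchemeII, Thm. 3.1 (p. 1173: the point attached to φ : L_0 → E)] -/
noncomputable def attXi (i : Fin (attN p e + 1)) : Polynomial k :=
  Polynomial.C (attC k p e u i) * Polynomial.X

/-- The defining homomorphism `k[X_0..X_N] → k[T]`, `X_i ↦ c_i T`, scalars through `F^e : k → k`.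
[cite: Oda1983HironakaGroupSchemeII, §2 (p. 1168: the twist F^e identifying F^{-e}(k) ⊗ L_0 with L_e)] -/
noncomputable def attPsi : MvPolynomial (Fin (attN p e + 1)) k →+* Polynomial k :=
  eval₂Hom (Polynomial.C.comp (iterateFrobenius k p e : k →+* k)) (attXi k p e u)

/-- The same map with `T = 1`: `k[X] → k`, `X_i ↦ c_i`, scalars through `F^e`. [folklore] -/
noncomputable def attChi : MvPolynomial (Fin (attN p e + 1)) k →+* k :=
  eval₂Hom (iterateFrobenius k p e : k →+* k) (attC k p e u)

/-- **The point** `attP = ker(X_i ↦ c_i T)` of `k[X_0, …, X_N]` over an arbitrary field `k ∋ u_0, u_1`.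
[cite: Mizutani1973HironakaGroupSchemes, Remark 2.10 (the schemes H_e; in-house proof §10, Cor. 10.1)] -/
noncomputable def attP : Ideal (MvPolynomial (Fin (attN p e + 1)) k) := RingHom.ker (attPsi k p e u)

variable {k p e u}

/-- `attPsi` on a monomial: `a X^m ↦ (F^e a · c^m) T^{|m|}`. [folklore] -/
theorem attPsi_monomial (m : Fin (attN p e + 1) →₀ ℕ) (a : k) :
    attPsi k p e u (monomial m a) = Polynomial.monomial m.degree (attChi k p e u (monomial m a)) := by
  unfold attPsi attChi
  rw [eval₂Hom_monomial, eval₂Hom_monomial, RingHom.comp_apply, ← Polynomial.C_mul_X_pow_eq_monomial, map_mul,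
    mul_assoc]
  congr 1
  unfold attXi
  rw [Finsupp.degree_apply, Finsupp.prod, Finsupp.prod, map_prod, ← Finset.prod_pow_eq_pow_sum,
    ← Finset.prod_mul_distrib]
  refine Finset.prod_congr rfl fun i _ => ?_
  rw [mul_pow, map_pow]

/-- `attPsi` on a homogeneous polynomial of degree `d` is `attChi(φ) · T^d`. [folklore] -/
theorem attPsi_of_isHomogeneous {φ : MvPolynomial (Fin (attN p e + 1)) k} {d : ℕ}
    (hφ : φ.IsHomogeneous d) : attPsi k p e u φ = Polynomial.monomial d (attChi k p e u φ) := by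
  conv_lhs => rw [φ.as_sum]
  conv_rhs => rw [φ.as_sum]
  rw [map_sum, map_sum, map_sum]
  refine Finset.sum_congr rfl fun m hm => ?_
  have hmd : m.degree = d := by
    have h := hφ (mem_support_iff.mp hm)
    rw [Finsupp.degree_eq_weight_one]
    exact h
  rw [attPsi_monomial, hmd]

/-- The `T^d`-coefficient of `attPsi f` is `attChi` of the degree-`d` homogeneous component of `f`. [folklore] -/
theorem coeff_attPsi (f : MvPolynomial (Fin (attN p e + 1)) k) (d : ℕ) :
    (attPsi k p e u f).coeff d = attChi k p e u (homogeneousComponent d f) := by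
  classical
  conv_lhs => rw [← sum_homogeneousComponent f, map_sum]
  rw [Polynomial.finsetSum_coeff]
  have hterm : ∀ i ∈ Finset.range (f.totalDegree + 1),
      (attPsi k p e u (homogeneousComponent i f)).coeff d =
        if i = d then attChi k p e u (homogeneousComponent d f) else 0 := by
    intro i _
    rw [attPsi_of_isHomogeneous (homogeneousComponent_isHomogeneous i f), Polynomial.coeff_monomial]
    by_cases hid : i = d
    · subst hid; simp
    · simp [hid]
  rw [Finset.sum_congr rfl hterm, Finset.sum_ite_eq' (Finset.range (f.totalDegree + 1)) d]
  split_ifs with hd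
  · rfl
  · rw [Finset.mem_range, not_lt] at hd
    rw [homogeneousComponent_eq_zero d f (by omega), map_zero]

/-- **`attP` is homogeneous**: with `f` it contains every homogeneous component of `f`. [cite: Oda1983HironakaGroupSchemeII, §2 (p. 1168: homogeneous prime ideals 𝔭 ≠ S_+)] -/
theorem homogeneousComponent_mem_attP {f : MvPolynomial (Fin (attN p e + 1)) k}
    (hf : f ∈ attP k p e u) (d : ℕ) : homogeneousComponent d f ∈ attP k p e u := by
  unfold attP at hf ⊢
  rw [RingHom.mem_ker] at hf ⊢
  rw [attPsi_of_isHomogeneous (homogeneousComponent_isHomogeneous d f), ← coeff_attPsi, hf,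
    Polynomial.coeff_zero, map_zero]

omit [CharP k p] in
/-- `c_i ≠ 0` as soon as `u_0, u_1 ≠ 0`. [folklore] -/
theorem attC_ne_zero (hu : ∀ l, u l ≠ 0) (i : Fin (attN p e + 1)) : attC k p e u i ≠ 0 := by
  unfold attC
  exact Finset.prod_ne_zero_iff.mpr fun l _ => pow_ne_zero _ (hu l)

/-- **`attP` is a point of `ℙ^N`** in Oda's sense: a homogeneous prime not containing the irrelevant ideal.
[cite: Oda1983HironakaGroupSchemeII, §2 (p. 1168: "a homogeneous prime ideal 𝔭 of S with 𝔭 ≠ S_+")] -/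
theorem isPoint_attP (hu : ∀ l, u l ≠ 0) : IsPoint k (attP k p e u) := by
  refine ⟨RingHom.ker_isPrime _, fun f hf d => homogeneousComponent_mem_attP hf d, fun hle => ?_⟩
  have hX : (X 0 : MvPolynomial (Fin (attN p e + 1)) k) ∈ irrelevant k (attN p e) := by
    unfold irrelevant; rw [RingHom.mem_ker, constantCoeff_X]
  have h := hle hX
  unfold attP at h
  rw [RingHom.mem_ker] at h
  unfold attPsi at h
  rw [eval₂Hom_X'] at h
  unfold attXi at h
  rw [mul_eq_zero, Polynomial.C_eq_zero] at h
  rcases h with h | h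
  · exact attC_ne_zero hu 0 h
  · exact Polynomial.X_ne_zero h

/-- `attP ≠ ⊤` (it is a prime ideal). [folklore] -/
theorem attP_ne_top : attP k p e u ≠ ⊤ := (RingHom.ker_isPrime (attPsi k p e u)).ne_top

/-! ### Additive forms in `attP` -/

/-- `c_i^{p^e · p^m} = F^e (c_i^{p^m})`. [folklore] -/
theorem attC_pow_pow (m : ℕ) (i : Fin (attN p e + 1)) :
    attC k p e u i ^ p ^ (e + m) = iterateFrobenius k p e (attC k p e u i ^ p ^ m) := by
  rw [iterateFrobenius_def, ← pow_mul, ← pow_add, add_comm]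

/-- **An additive form of level `e + m` lies in `attP` iff `Σ_i g_i c_i^{p^m} = 0`.**
[cite: Oda1983HironakaGroupSchemeII, Lemma 2.1 (p. 1169: Q = 𝔭 ∩ L)] -/
theorem addForm_mem_attP_iff (m : ℕ) (g : Fin (attN p e + 1) → k) :
    addForm k p (e + m) g ∈ attP k p e u ↔ ∑ i, g i * attC k p e u i ^ p ^ m = 0 := by
  unfold attP addForm
  rw [RingHom.mem_ker, map_sum]
  have hterm : ∀ i, attPsi k p e u (C (g i) * X i ^ p ^ (e + m)) =
      Polynomial.C (iterateFrobenius k p e (g i * attC k p e u i ^ p ^ m)) * Polynomial.X ^ p ^ (e + m) := by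
    intro i
    unfold attPsi
    rw [map_mul, map_pow, eval₂Hom_C, eval₂Hom_X', RingHom.comp_apply]
    unfold attXi
    rw [mul_pow, ← map_pow, attC_pow_pow, map_mul, map_mul]
    ring
  rw [Finset.sum_congr rfl fun i _ => hterm i, ← Finset.sum_mul, ← map_sum, ← map_sum, mul_eq_zero,
    Polynomial.C_eq_zero, map_eq_zero_iff _ (iterateFrobenius k p e).injective]
  constructor
  · rintro (h | h)
    · exact h
    · exact absurd h (pow_ne_zero _ Polynomial.X_ne_zero)
  · intro h; exact Or.inl h

/-! ### The invariant forms as tensors -/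

variable (k p e u) in
/-- `β_m(a) = Σ_i a_i ⊗ c_i^{p^m} ∈ k ⊗_{k^{p^{e+m}}} k`. [cite: Mizutani1973HironakaGroupSchemes, Remark 2.10 (in-house proof §10: ω = Σ a_i ⊗ c_i, N(H))] -/
noncomputable def attBeta (m : ℕ) (a : Fin (attN p e + 1) → k) : k ⊗[frobPow k p (e + m)] k :=
  ∑ i, a i ⊗ₜ[frobPow k p (e + m)] (attC k p e u i ^ p ^ m)

/-- **`a ∈ (L_B)_{e+m}(attP) ⟺ β_m(a) ∈ J^{p^{e+m}}`**: Oda's differential-operator definition of the invariant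
additive forms, read in the tensor square through Grothendieck duality (encloser-2's `mem_ideal_pow_iff_forall_dPair`),
over an arbitrary field. [cite: Oda1983HironakaGroupSchemeII, §2 (p. 1168) and Cor. 2.3 (p. 1171)] -/
theorem mem_invForms_attP_iff (m : ℕ) (a : Fin (attN p e + 1) → k) :
    a ∈ invForms k p (attP k p e u) (e + m) ↔
      attBeta k p e u m a ∈ KaehlerDifferential.ideal (frobPow k p (e + m)) k ^ p ^ (e + m) := by
  have hq : p ^ (e + m) = (p ^ (e + m) - 1) + 1 := (Nat.sub_add_cancel (Nat.one_le_pow _ _ hp.out.pos)).symm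
  have hpair : ∀ D : k →ₗ[frobPow k p (e + m)] k,
      dPair (frobPow k p (e + m)) (AlgHom.id _ _) D (attBeta k p e u m a) =
        ∑ i, D (a i) * attC k p e u i ^ p ^ m := by
    intro D
    unfold attBeta
    rw [map_sum]
    exact Finset.sum_congr rfl fun i _ => by rw [dPair_tmul, AlgHom.id_apply]
  have key := mem_ideal_pow_iff_forall_dPair (frobPow k p (e + m)) (p ^ (e + m) - 1) (attBeta k p e u m a)
  rw [← hq] at key
  rw [key]
  constructor
  · intro ha D hD
    rw [hpair, ← addForm_mem_attP_iff]
    exact ha D hD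
  · intro h D hD
    show addForm k p (e + m) (fun j => D (a j)) ∈ attP k p e u
    rw [addForm_mem_attP_iff, ← hpair]
    exact h D hD

omit [CharP k p] in
/-- `c_i^{p^m} = u^{p^m W_i}`. [folklore] -/
theorem attC_pow (m : ℕ) (i : Fin (attN p e + 1)) :
    attC k p e u i ^ p ^ m = ∏ l, u l ^ (p ^ m • attW p e i) l := by
  unfold attC
  rw [← Finset.prod_pow]
  exact Finset.prod_congr rfl fun l _ => by rw [← pow_mul, Finsupp.smul_apply, smul_eq_mul, mul_comm]

/-! ### `p`-independent pairs -/

/-- A `p`-independent family has nonzero members (`b_i = b^{e_i}` is one of the independent monomials).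
[cite: Mizutani1973HironakaGroupSchemes, Lemma 2.4 (p. 88)] -/
theorem ne_zero_of_pIndep {s : ℕ} {b : Fin s → k} (hb : PIndep p 1 b) (i : Fin s) : b i ≠ 0 := by
  have hp1 : 1 < p ^ 1 := by rw [pow_one]; exact hp.out.one_lt
  have h := hb.ne_zero (Pi.single i ⟨1, hp1⟩)
  have hm : fmon b (Pi.single i (⟨1, hp1⟩ : Fin (p ^ 1))) = b i := by
    unfold fmon
    rw [Finset.prod_eq_single i]
    · rw [Pi.single_eq_same]; exact pow_one _
    · intro j _ hji
      rw [Pi.single_eq_of_ne hji]; exact pow_zero _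
    · intro h; exact absurd (Finset.mem_univ i) h
  rwa [hm] at h

/-- A `p`-independent family is injective (`b_i = b_j` would be a relation between two monomials).
[cite: Mizutani1973HironakaGroupSchemes, Lemma 2.4 (p. 88)] -/
theorem injective_of_pIndep {s : ℕ} {b : Fin s → k} (hb : PIndep p 1 b) : Function.Injective b := by
  intro i j hij
  by_contra hne
  have hp1 : 1 < p ^ 1 := by rw [pow_one]; exact hp.out.one_lt
  have hmon : ∀ l : Fin s, fmon b (Pi.single l (⟨1, hp1⟩ : Fin (p ^ 1))) = b l := by
    intro l
    unfold fmon
    rw [Finset.prod_eq_single l]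
    · rw [Pi.single_eq_same]; exact pow_one _
    · intro j' _ hj
      rw [Pi.single_eq_of_ne hj]; exact pow_zero _
    · intro h; exact absurd (Finset.mem_univ l) h
  have hW : (Pi.single i (⟨1, hp1⟩ : Fin (p ^ 1)) : Fin s → Fin (p ^ 1)) ≠ Pi.single j ⟨1, hp1⟩ := by
    intro h
    have := congrFun h i
    rw [Pi.single_eq_same, Pi.single_eq_of_ne hne] at this
    exact absurd (congrArg Fin.val this) (by simp)
  exact hW (hb.injective (by rw [hmon, hmon, hij]))

/-- Two distinct box monomials of a `p`-independent family satisfy no nontrivial `k^p`-relation. [cite: Mizutani1973HironakaGroupSchemes, Lemma 2.4 (p. 88)] -/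
theorem rel_pair_of_pIndep {s : ℕ} {b : Fin s → k} (hb : PIndep p 1 b) {W₀ W₁ : Fin s → Fin (p ^ 1)}
    (hne : W₁ ≠ W₀) (c₀ c₁ : frobPow k p 1) (h : c₀ • fmon b W₀ + c₁ • fmon b W₁ = 0) : c₀ = 0 ∧ c₁ = 0 := by
  classical
  have key := (linearIndependent_iff'.mp hb) {W₀, W₁} (fun W => if W = W₀ then c₀ else c₁) (by
    rw [Finset.sum_pair hne.symm, if_pos rfl, if_neg hne]
    exact h)
  refine ⟨?_, ?_⟩
  · have := key W₀ (Finset.mem_insert_self _ _)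
    rwa [if_pos rfl] at this
  · have := key W₁ (Finset.mem_insert_of_mem (Finset.mem_singleton_self _))
    rwa [if_neg hne] at this

/-- A member of a `p`-independent family is not a `p`-th power (`b_i = y^p` would be a `k^p`-relation between the
monomials `1` and `b_i`). [cite: Mizutani1973HironakaGroupSchemes, Lemma 2.4 (p. 88: p-independent over k^p)] -/
theorem not_mem_frobPow_of_pIndep {s : ℕ} {b : Fin s → k} (hb : PIndep p 1 b) (i : Fin s) :
    b i ∉ frobPow k p 1 := by
  classical
  intro hmem
  have hp1 : 1 < p ^ 1 := by rw [pow_one]; exact hp.out.one_lt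
  set W₀ : Fin s → Fin (p ^ 1) := fun _ => ⟨0, by omega⟩ with hW₀
  set W₁ : Fin s → Fin (p ^ 1) := Function.update W₀ i ⟨1, hp1⟩ with hW₁
  have hne : W₁ ≠ W₀ := by
    intro h
    have := congrArg (fun W => (W i : ℕ)) h
    simp [hW₁, hW₀] at this
  have h0 : fmon b W₀ = 1 := by
    unfold fmon; exact Finset.prod_eq_one fun j _ => by simp [hW₀]
  have h1 : fmon b W₁ = b i := by
    unfold fmon
    rw [Finset.prod_eq_single i]
    · simp [hW₁]
    · intro j _ hj; simp [hW₁, Function.update_of_ne hj, hW₀]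
    · intro h; exact absurd (Finset.mem_univ i) h
  -- the relation `b_i · b^{W₀} + (−1) · b^{W₁} = 0` with coefficients in `k^p`
  have hrel : (⟨b i, hmem⟩ : frobPow k p 1) • fmon b W₀ + (-1 : frobPow k p 1) • fmon b W₁ = 0 := by
    rw [h0, h1, Subfield.smul_def, Subfield.smul_def, smul_eq_mul, smul_eq_mul, mul_one]
    simp
  have := (rel_pair_of_pIndep hb hne _ _ hrel).2
  exact one_ne_zero (neg_eq_zero.mp this)

end Point

end Summit.ResolutionOfSingularities.KangarooAtlas.Mizutani.GenAtt
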